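import Summits.BirchSwinnertonDyer.BirchSwinnertonDyer.Theorems.EisensteinPrimesIndexInputsShell
import Summits.BirchSwinnertonDyer.BirchSwinnertonDyer.Theorems.EisensteinPrimesIndexInputsH2
import Summits.BirchSwinnertonDyer.BirchSwinnertonDyer.Theorems.EisensteinPrimesSplitMultLocalHZero
import HarnessLib

/-!
# Crux 4 `BSDpOnCellC` (stmt-BirchSwinnertonDyer-19034), line b1 — the SPLIT conjunct of the wall `stub_imprimitiveCount`:
# THE ∃-PACKAGE OF INPUTS of the x1 V21 index road (the 35 conjuncts (R), Kummer, (U), SUR ×3, COT ×6, H⁰ ×13, H²)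
# AT A SPLIT MULTIPLICATIVE DATUM, orientation (ω, 𝟙), modulo the Greenberg facts and `cd_p(G_{K,Σ}) ≤ 2` BY NAME

Cell `bsd-eis` (run/shared/lean/pub/bsd-eis/), width seat `bsd-line-x2-p2` gen 10 (`--supports -19034`, closes nothing; skeleton of
record b1 v12 sha256 155e218d… UNCHANGED, W-79). Sequel of p672062 (`…SplitMultLocalHZero`) and `…SplitMultIndexPlumbing`.

WHY. The x1 cell closed its kernel stub `stub_indexInputs` (crux 2, good anomalous lattice) as
`GoodLatticeBDPValueIndexStubs.indexInputs` = `IndexInputsShell.indexInputs_of_H2` (width seat x1-p1-w7) + `IndexInputsH2.natCard_H2_conjunct`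
(x1-p1-w4 g5). Every producer inside is REDUCTION-TYPE FREE — (R) `IndexInputsReps`, the Kummer data of `ResidualPairStableLine`, (U)
`IndexInputsUnramified` (Néron–Ogg–Shafarevich OFF `Sf ∪ {w ∣ p}`), SUR ×3 `AcTwistDeformationSurAtVbar{Fin,OfForallDatum}` (Greenberg 2016
Prop. 2.6.3 by name), COT `IndexInputsCot`, `H²` `IndexInputsH2` (weak Leopoldt above `K_∞` + `cd_p ≤ 2`) — EXCEPT the local `H⁰` package,
which used `Anom W p` + «no unramified rational line» and is replaced here by this seat's `SplitMultLocalHZero.hZero_package_of_split`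
(p672062). THIS FILE is the split twin of the shell: `indexInputs_split` states x1's ∃-package VERBATIM (x1's ORDER AND TYPES, so that the
mid-level composition `ResidualIndexAssembly.zpCorank_datumStrictSelmer_add_eq` and this seat's `lambdaInvariant_add_le_of_mid_split` consume it
unchanged) on the binders: `2 < p` SPLIT multiplicative for `W/ℚ` (globally minimal), `K` imaginary quadratic with (Heeg) for `N_W` and `(p)`
split, `E(K)[p] = 0`, `v` through `ι`, `v̄ ∋ p`, `v̄ ≠ v`, `κ` anticyclotomic with topological generator `γ`, a residual pair `(θsub, θquot)`
with some `τ ∈ D_v̄`, `θsub(τ) ≠ 1` (orientation (ω, 𝟙)), `Sf` in x1's convention `w ∈ Sf ↔ N_W ∈ w` (at `p ∣ N` it contains the places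
over `p`, which no Selmer condition of the road reads — every «outside `S`» clause is imposed at `w ∤ p` only), the cotorsion clauses
(`𝔛^{Sf}_f` f.g. torsion `μ = 0`; `∀ D` for both characters), GRANTED Greenberg 2016 Prop. 2.6.3, Greenberg 2006 Props. 4.1, 4.2, §5 A, 3.2
and `cd_p(G_{K,Σ}) ≤ 2` (NSW (8.3.18)) BY NAME.

HONEST FRAMING: helper theorem only (0 defs, 0 named facts introduced, 0 sorry); CONDITIONAL on the six named published facts it takes as
hypotheses (all already hypotheses of the x1 line and of line b1's chain); closes no stub; no summit statement / BSD / MC / IMC / KY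
Thm. 1.4.1 (iii) is proved for any curve; 0 cells / labels / tiers move.

References: [KellerYin2024] Prop. 1.3.2, Thm. 1.4.1, §1.4, §5.1 (arXiv:2402.12781v2 TeX L700–760, L1087–1330, L1725–1769);
[Greenberg2016Selmer] Prop. 2.6.3; [Greenberg2006] Props. 3.2, 4.1, 4.2, §5 A; [NeukirchSchmidtWingberg2008] (8.3.18); [GreenbergVatsal2000]
§2 pp. 14–15; [PollackWeston2011] Prop. A.2; the x1 road memo `Cruxes/GoodLatticeBDPValue/Lines/halves-imprimLambda-index-road.md`.
-/

set_option autoImplicit false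
-- the route's Theorems namespace repeats the summit name by design (D-0017 nested layout)
set_option linter.dupNamespace false

noncomputable section

open scoped Classical

namespace Summit.BirchSwinnertonDyer.BirchSwinnertonDyer.Theorems.SplitMultIndexInputs

open PowerSeries WeierstrassCurve NumberField IsDedekindDomain Field
  Literature.NumberTheory.GaloisRepresentations Literature.NumberTheory.EllipticCurves.GreenbergVatsal2000
  Literature.NumberTheory.EllipticCurves Literature.NumberTheory.EllipticCurves.Rank1Residual
  Literature.NumberTheory.EllipticCurves.Castella2018 Literature.NumberTheory.EllipticCurves.GreenbergSelmer
  Literature.NumberTheory.QuadraticFields Literature.NumberTheory.EllipticCurves.KellerYin2024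
  Literature.NumberTheory.EllipticCurves.IwasawaAlgebra Literature.NumberTheory.IwasawaTheory
  Literature.NumberTheory.IwasawaTheory.Greenberg2016 Literature.NumberTheory.IwasawaTheory.Greenberg2006
  Literature.NumberTheory.GaloisCohomology
  Literature.NumberTheory.EllipticCurves.FineSelmerCoefficientMap
  Summit.BirchSwinnertonDyer.Rank1Residual.X2.ResidualDevissageModules
  Summit.BirchSwinnertonDyer.BirchSwinnertonDyer.Theorems
  Summit.BirchSwinnertonDyer.BirchSwinnertonDyer.Theorems.IndexInputsShell

/-- **COT ×6 and the thirteen `H⁰` conjuncts at a SPLIT multiplicative datum, bundled** (x1's `IndexInputsShell.cot_hZero_package` with its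
`Anom`-package replaced by `SplitMultLocalHZero.hZero_package_of_split`): x1-w5's `IndexInputsCot` (from the cotorsion antecedents) and p672062,
for any line datum `Φ` with `#Φ.Sub = #Φ.Quot = p` and equivariant injective `j₁ : Φ.Sub ↪ (F/𝒪)(θsub)`, `j₃ : Φ.Quot ↪ (F/𝒪)(θquot)`, at
the orientation (ω, 𝟙) (`∃ τ ∈ D_v̄, θsub(τ) ≠ 1`); the `hfinED` component kept (x1 drops it).
[cite: KellerYin2024, Thm. 1.4.1 (i)–(ii) and §1.4 (arXiv:2402.12781v2 TeX L1087–1098, L1178–1330)] [cite: GreenbergVatsal2000, §2 pp. 14–15] -/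
theorem cot_hZero_package_split
    (W : WeierstrassCurve ℚ) [W.IsElliptic] [W.IsGloballyMinimal] (p : ℕ) [Fact p.Prime]
    (hp : 2 < p) (hsplitred : W.HasSplitMultiplicativeReductionAtPrime p)
    (K : Type) [Field K] [NumberField K] (hK : IsImaginaryQuadratic K)
    (hsplit : ((Ideal.span {(p : ℤ)}).primesOver (𝓞 K)).ncard = 2)
    (htor : ∀ Q : (W.baseChange K).toAffine.Point, p • Q = 0 → Q = 0)
    (vbar : HeightOneSpectrum (𝓞 K)) (hvbar : ((p : ℕ) : 𝓞 K) ∈ vbar.asIdeal)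
    (κ : ZpExtension K p) (hκ : κ.IsAnticyclotomic)
    (γ : absoluteGaloisGroup K) [Fact (κ.IsTopGenerator γ)]
    (θsub θquot : FramedGaloisRep K (padicCoeffIntegers (∅ : Set (PadicAlgCl p))) 1)
    (hpair : IsResidualPairOver (W.baseChange K) p θsub θquot)
    (hram : ∃ τ ∈ decomp vbar, unitChar θsub τ ≠ 1)
    (Sf : Finset (HeightOneSpectrum (𝓞 K)))
    (hSf : ∀ w : HeightOneSpectrum (𝓞 K), w ∈ Sf ↔ ((W.conductorNorm ℤ : ℤ) : 𝓞 K) ∈ w.asIdeal)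
    (hfgS : Module.Finite (IwasawaAlgebra p) (AcSelmer.XAc (W.baseChange K) p κ vbar (↑Sf : Set (HeightOneSpectrum (𝓞 K))) γ))
    (htorS : Module.IsTorsion (IwasawaAlgebra p) (AcSelmer.XAc (W.baseChange K) p κ vbar (↑Sf : Set (HeightOneSpectrum (𝓞 K))) γ))
    (hμS : muInvariant p (AcSelmer.XAc (W.baseChange K) p κ vbar (↑Sf : Set (HeightOneSpectrum (𝓞 K))) γ) = 0)
    (hSsub : ∀ D : DatumDualData κ γ (charModule ∅ θsub)
        (AcSelmer.bdpData (charModule ∅ θsub) p vbar) (↑Sf : Set (HeightOneSpectrum (𝓞 K))),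
      Module.Finite (IwasawaAlgebra p) D.X ∧ Module.IsTorsion (IwasawaAlgebra p) D.X ∧ muInvariant p D.X = 0)
    (hSquot : ∀ D : DatumDualData κ γ (charModule ∅ θquot)
        (AcSelmer.bdpData (charModule ∅ θquot) p vbar) (↑Sf : Set (HeightOneSpectrum (𝓞 K))),
      Module.Finite (IwasawaAlgebra p) D.X ∧ Module.IsTorsion (IwasawaAlgebra p) D.X ∧ muInvariant p D.X = 0)
    (Φ : StableSubgroup (absoluteGaloisGroup K) ↥((W.baseChange K).geomTorsion (p : ℤ)))
    (hSub : Nat.card Φ.Sub = p) (hQuot : Nat.card Φ.Quot = p)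
    (j₁ : Φ.Sub →+ charModule ∅ θsub)
    (hj₁ : ∀ (g : absoluteGaloisGroup K) (a : Φ.Sub), j₁ (g • a) = g • j₁ a) (hj₁inj : Function.Injective j₁)
    (j₃ : Φ.Quot →+ charModule ∅ θquot)
    (hj₃ : ∀ (g : absoluteGaloisGroup K) (a : Φ.Quot), j₃ (g • a) = g • j₃ a) (hj₃inj : Function.Injective j₃) :
        (∀ s : (datumStrictSelmer κ.kerSubgroup (charModule ∅ θsub) p (AcSelmer.bdpData (charModule ∅ θsub) p vbar) (↑Sf : Set (HeightOneSpectrum (𝓞 K)))), ∃ n : ℕ, p ^ n • s = 0) ∧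
        (∀ s : (datumStrictSelmer κ.kerSubgroup ↥((W.baseChange K).geomPrimaryTorsion p) p (AcSelmer.bdpData ↥((W.baseChange K).geomPrimaryTorsion p) p vbar) (↑Sf : Set (HeightOneSpectrum (𝓞 K)))), ∃ n : ℕ, p ^ n • s = 0) ∧
        (∀ s : (datumStrictSelmer κ.kerSubgroup (charModule ∅ θquot) p (AcSelmer.bdpData (charModule ∅ θquot) p vbar) (↑Sf : Set (HeightOneSpectrum (𝓞 K)))), ∃ n : ℕ, p ^ n • s = 0) ∧
        Finite (AddSubgroup.torsionBy (datumStrictSelmer κ.kerSubgroup (charModule ∅ θsub) p (AcSelmer.bdpData (charModule ∅ θsub) p vbar) (↑Sf : Set (HeightOneSpectrum (𝓞 K)))) (p : ℤ)) ∧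
        Finite (AddSubgroup.torsionBy (datumStrictSelmer κ.kerSubgroup ↥((W.baseChange K).geomPrimaryTorsion p) p (AcSelmer.bdpData ↥((W.baseChange K).geomPrimaryTorsion p) p vbar) (↑Sf : Set (HeightOneSpectrum (𝓞 K)))) (p : ℤ)) ∧
        Finite (AddSubgroup.torsionBy (datumStrictSelmer κ.kerSubgroup (charModule ∅ θquot) p (AcSelmer.bdpData (charModule ∅ θquot) p vbar) (↑Sf : Set (HeightOneSpectrum (𝓞 K)))) (p : ℤ)) ∧
        (∀ x : (charModule ∅ θsub), (∀ g : ↥κ.kerSubgroup, g • x = x) → ∃ x' : (charModule ∅ θsub), (∀ g : ↥κ.kerSubgroup, g • x' = x') ∧ p • x' = x) ∧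
        (∀ x : ↥((W.baseChange K).geomPrimaryTorsion p), (∀ g : ↥κ.kerSubgroup, g • x = x) → ∃ x' : ↥((W.baseChange K).geomPrimaryTorsion p), (∀ g : ↥κ.kerSubgroup, g • x' = x') ∧ p • x' = x) ∧
        (∀ x : (charModule ∅ θquot), (∀ g : ↥κ.kerSubgroup, g • x = x) → ∃ x' : (charModule ∅ θquot), (∀ g : ↥κ.kerSubgroup, g • x' = x') ∧ p • x' = x) ∧
        (∀ n : ↥((W.baseChange K).geomTorsion (p : ℤ)), (∀ g : ↥κ.kerSubgroup, g • n = n) → n = 0) ∧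
        Finite {n : Φ.Quot // ∀ g : ↥κ.kerSubgroup, g • n = n} ∧
        Nat.card {n : Φ.Quot // ∀ g : ↥κ.kerSubgroup, g • n = n} = p ^ (if ∀ σ : absoluteGaloisGroup K, θquot σ = 1 then 1 else 0) ∧
        (∀ n : Φ.Sub, (∀ g : ↥(κ.kerSubgroup ⊓ decomp vbar), g • n = n) → n = 0) ∧
        (∀ (g : ↥(κ.kerSubgroup ⊓ decomp vbar)) (n : Φ.Quot), g • n = n) ∧
        Finite Φ.Quot ∧ Nat.card Φ.Quot = p ∧
        Finite {x : ↥((W.baseChange K).geomPrimaryTorsion p) // ∀ g : ↥(κ.kerSubgroup ⊓ decomp vbar), g • x = x} ∧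
        (∀ x : (charModule ∅ θsub), (∀ g : ↥(κ.kerSubgroup ⊓ decomp vbar), g • x = x) → ∃ x' : (charModule ∅ θsub), (∀ g : ↥(κ.kerSubgroup ⊓ decomp vbar), g • x' = x') ∧ p • x' = x) ∧
        (∀ x : (charModule ∅ θquot), (∀ g : ↥(κ.kerSubgroup ⊓ decomp vbar), g • x = x) → ∃ x' : (charModule ∅ θquot), (∀ g : ↥(κ.kerSubgroup ⊓ decomp vbar), g • x' = x') ∧ p • x' = x) := by
  have hp2 : p ≠ 2 := by omega
  obtain ⟨hprim₁, hfin₁⟩ := IndexInputsCot.isPrimary_and_finite_torsionBy_datumStrictSelmer_charModule_of_forall p vbar κ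
    γ θsub (↑Sf : Set (HeightOneSpectrum (𝓞 K))) hSsub
  obtain ⟨hprim₃, hfin₃⟩ := IndexInputsCot.isPrimary_and_finite_torsionBy_datumStrictSelmer_charModule_of_forall p vbar κ
    γ θquot (↑Sf : Set (HeightOneSpectrum (𝓞 K))) hSquot
  haveI := hfgS
  obtain ⟨hprim₂, hfin₂⟩ := IndexInputsCot.isPrimary_and_finite_torsionBy_datumStrictSelmer_curve W p K vbar κ Sf hK hvbar
    γ hSf htorS hμS
  obtain ⟨hinv₁, hinv₂, hinv₃, hN₂, hfinq, hε, hN₁D, htrivD, hfinQ, hN₃, hfinED, hinvD₁, hinvD₃⟩ :=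
    SplitMultLocalHZero.hZero_package_of_split W p hp2 hsplitred K hK hsplit htor vbar hvbar κ hκ θsub θquot hpair hram Φ hSub hQuot
      j₁ hj₁ hj₁inj j₃ hj₃ hj₃inj
  exact ⟨hprim₁, hprim₂, hprim₃, hfin₁, hfin₂, hfin₃, hinv₁, hinv₂, hinv₃, hN₂, hfinq, hε, hN₁D, htrivD, hfinQ, hN₃, hfinED, hinvD₁,
    hinvD₃⟩

/-- **THE ∃-PACKAGE OF THE V21 INDEX ROAD AT A SPLIT MULTIPLICATIVE DATUM, orientation (ω, 𝟙)** — x1's `stub_indexInputs` conclusion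
VERBATIM (35 conjuncts: (R), Kummer, (U), SUR ×3, COT ×6, global/local `H⁰` ×13, `H²`), on the binders `2 < p` SPLIT multiplicative for `W/ℚ`,
`K` imaginary quadratic with (Heeg) for `N_W` and `(p)` split, `E(K)[p] = 0`, `v` through `ι`, `v̄ ∋ p`, `v̄ ≠ v`, `κ` anticyclotomic with
topological generator `γ`, `(θsub, θquot)` a residual pair with some `τ ∈ D_v̄`, `θsub(τ) ≠ 1`, `Sf` with `w ∈ Sf ↔ N_W ∈ w`, the cotorsion
clauses, GRANTED Greenberg 2016 Prop. 2.6.3 (`prop263_sur_of_crk`), Greenberg 2006 Props. 4.1, 4.2, §5 A, 3.2 and `cd_p(G_{K,Σ}) ≤ 2`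
(`groupCdLE_two_galoisGroupUnramifiedOutside K`) BY NAME. Witnesses: `c` with `κ(D_v̄) = p^c ℤ_p`, `τ = (γ ^ ·)`, the residual line of
`IsResidualPairOver`; producers: x1's (R) `IndexInputsReps`, Kummer `ResidualPairStableLine`, (U) `IndexInputsUnramified`, SUR
`IndexInputsShell.sur_package`, `H²` `IndexInputsH2.natCard_H2_conjunct`, and §'s `cot_hZero_package_split`.
[cite: KellerYin2024, Prop. 1.3.2, Thm. 1.4.1 and §1.4, §5.1 (arXiv:2402.12781v2 TeX L700–760, L1087–1330, L1725–1769)]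
[cite: Greenberg2016Selmer, Prop. 2.6.3] [cite: Greenberg2006, Props. 3.2, 4.1, 4.2, §5 A] [cite: NeukirchSchmidtWingberg2008, (8.3.18)]
[cite: GreenbergVatsal2000, §2 pp. 14–15] [cite: PollackWeston2011, Prop. A.2] -/
theorem indexInputs_split (h263 : prop263_sur_of_crk) (h41 : prop41_globalEulerPoincareCorank)
    (h42 : prop42_localEulerPoincareCorank) (h5A : sec5A_localH2_subsingleton_of_LOC1)
    (h32 : prop32_cohomology_isCofinitelyGenerated)
    (W : WeierstrassCurve ℚ) [W.IsElliptic] [W.IsGloballyMinimal] (p : ℕ) [Fact p.Prime]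
    (hp : 2 < p) (hsplitred : W.HasSplitMultiplicativeReductionAtPrime p)
    (K : Type) [Field K] [NumberField K] (hK : IsImaginaryQuadratic K)
    (hCD2 : groupCdLE_two_galoisGroupUnramifiedOutside K)
    (hH : SatisfiesHeegnerHypothesis (W.conductorNorm ℤ) K)
    (hsplit : ((Ideal.span {(p : ℤ)}).primesOver (𝓞 K)).ncard = 2)
    (htor : ∀ Q : (W.baseChange K).toAffine.Point, p • Q = 0 → Q = 0)
    (ι : K →+* ℚ_[p]) (v vbar : HeightOneSpectrum (𝓞 K))
    (hv : ∀ x : 𝓞 K, x ∈ v.asIdeal ↔ ‖ι (x : K)‖ < 1)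
    (hvbar : ((p : ℕ) : 𝓞 K) ∈ vbar.asIdeal) (hne : vbar ≠ v)
    (κ : ZpExtension K p) (hκ : κ.IsAnticyclotomic)
    (γ : absoluteGaloisGroup K) [Fact (κ.IsTopGenerator γ)]
    (θsub θquot : FramedGaloisRep K (padicCoeffIntegers (∅ : Set (PadicAlgCl p))) 1)
    (hpair : IsResidualPairOver (W.baseChange K) p θsub θquot)
    (hram : ∃ τ ∈ decomp vbar, unitChar θsub τ ≠ 1)
    (Sf : Finset (HeightOneSpectrum (𝓞 K)))
    (hSf : ∀ w : HeightOneSpectrum (𝓞 K), w ∈ Sf ↔ ((W.conductorNorm ℤ : ℤ) : 𝓞 K) ∈ w.asIdeal)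
    (hfgS : Module.Finite (IwasawaAlgebra p) (AcSelmer.XAc (W.baseChange K) p κ vbar (↑Sf : Set (HeightOneSpectrum (𝓞 K))) γ))
    (htorS : Module.IsTorsion (IwasawaAlgebra p) (AcSelmer.XAc (W.baseChange K) p κ vbar (↑Sf : Set (HeightOneSpectrum (𝓞 K))) γ))
    (hμS : muInvariant p (AcSelmer.XAc (W.baseChange K) p κ vbar (↑Sf : Set (HeightOneSpectrum (𝓞 K))) γ) = 0)
    (hSsub : ∀ D : DatumDualData κ γ (charModule ∅ θsub)
        (AcSelmer.bdpData (charModule ∅ θsub) p vbar) (↑Sf : Set (HeightOneSpectrum (𝓞 K))),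
      Module.Finite (IwasawaAlgebra p) D.X ∧ Module.IsTorsion (IwasawaAlgebra p) D.X ∧ muInvariant p D.X = 0)
    (hSquot : ∀ D : DatumDualData κ γ (charModule ∅ θquot)
        (AcSelmer.bdpData (charModule ∅ θquot) p vbar) (↑Sf : Set (HeightOneSpectrum (𝓞 K))),
      Module.Finite (IwasawaAlgebra p) D.X ∧ Module.IsTorsion (IwasawaAlgebra p) D.X ∧ muInvariant p D.X = 0) :
      ∃ (c : ℕ) (τ : ℕ → absoluteGaloisGroup K)
        (Φ : StableSubgroup (absoluteGaloisGroup K) ↥((W.baseChange K).geomTorsion (p : ℤ)))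
        (j₁ : Φ.Sub →+ charModule ∅ θsub) (j₃ : Φ.Quot →+ charModule ∅ θquot)
        (hj₁ : ∀ (g : absoluteGaloisGroup K) (a : Φ.Sub), j₁ (g • a) = g • j₁ a)
        (hj₃ : ∀ (g : absoluteGaloisGroup K) (a : Φ.Quot), j₃ (g • a) = g • j₃ a),
        -- (R) representatives
        (∀ i : ℕ, κ (τ i) = Multiplicative.ofAdd ((i : ℕ) : ℤ_[p])) ∧
        (∀ i j : ℕ, i < p ^ c → j < p ^ c → i ≠ j → ∀ δ ∈ decomp vbar,
          Multiplicative.ofAdd ((j : ℕ) : ℤ_[p]) ≠ Multiplicative.ofAdd ((i : ℕ) : ℤ_[p]) * κ δ) ∧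
        (∀ x : subgroupH1 κ.kerSubgroup (charModule ∅ θsub),
          (∀ i, i < p ^ c → resOfLe (charModule ∅ θsub) (inf_le_left : κ.kerSubgroup ⊓ decomp vbar ≤ κ.kerSubgroup) (conjH1 κ.kerSubgroup (charModule ∅ θsub) (τ i) x) = 0) →
            ∀ σ : absoluteGaloisGroup K, resOfLe (charModule ∅ θsub) (inf_le_left : κ.kerSubgroup ⊓ decomp vbar ≤ κ.kerSubgroup) (conjH1 κ.kerSubgroup (charModule ∅ θsub) σ x) = 0) ∧
        (∀ x : subgroupH1 κ.kerSubgroup ↥((W.baseChange K).geomPrimaryTorsion p),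
          (∀ i, i < p ^ c → resOfLe ↥((W.baseChange K).geomPrimaryTorsion p) (inf_le_left : κ.kerSubgroup ⊓ decomp vbar ≤ κ.kerSubgroup) (conjH1 κ.kerSubgroup ↥((W.baseChange K).geomPrimaryTorsion p) (τ i) x) = 0) →
            ∀ σ : absoluteGaloisGroup K, resOfLe ↥((W.baseChange K).geomPrimaryTorsion p) (inf_le_left : κ.kerSubgroup ⊓ decomp vbar ≤ κ.kerSubgroup) (conjH1 κ.kerSubgroup ↥((W.baseChange K).geomPrimaryTorsion p) σ x) = 0) ∧
        (∀ x : subgroupH1 κ.kerSubgroup (charModule ∅ θquot),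
          (∀ i, i < p ^ c → resOfLe (charModule ∅ θquot) (inf_le_left : κ.kerSubgroup ⊓ decomp vbar ≤ κ.kerSubgroup) (conjH1 κ.kerSubgroup (charModule ∅ θquot) (τ i) x) = 0) →
            ∀ σ : absoluteGaloisGroup K, resOfLe (charModule ∅ θquot) (inf_le_left : κ.kerSubgroup ⊓ decomp vbar ≤ κ.kerSubgroup) (conjH1 κ.kerSubgroup (charModule ∅ θquot) σ x) = 0) ∧
        -- the Kummer embeddings
        Function.Injective j₁ ∧ Function.Injective j₃ ∧
        (∀ x : charModule ∅ θsub, x ∈ j₁.range ↔ p • x = 0) ∧ (∀ x : charModule ∅ θquot, x ∈ j₃.range ↔ p • x = 0) ∧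
        (∀ x : ↥((W.baseChange K).geomPrimaryTorsion p), x ∈ (AddSubgroup.inclusion (geomTorsion_le_geomPrimaryTorsion (W.baseChange K) p)).range ↔ p • x = 0) ∧
        (∀ x : ↥((W.baseChange K).geomPrimaryTorsion p), ∃ x' : ↥((W.baseChange K).geomPrimaryTorsion p), p • x' = x) ∧
        -- (U)
        (∀ w : HeightOneSpectrum (𝓞 K), w ∉ (↑Sf : Set (HeightOneSpectrum (𝓞 K))) → ((p : ℕ) : 𝓞 K) ∉ w.asIdeal →
          Function.Injective (resH1Hom (ContinuousMonoidHom.id (inertiaIn κ.kerSubgroup w)) Φ.incl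
            (fun g m ↦ Φ.incl_smul ((g : decomp (K := K) w) : absoluteGaloisGroup K) m))) ∧
        (∀ w : HeightOneSpectrum (𝓞 K), w ∉ (↑Sf : Set (HeightOneSpectrum (𝓞 K))) → ((p : ℕ) : 𝓞 K) ∉ w.asIdeal →
          Function.Injective (resH1Hom (ContinuousMonoidHom.id (inertiaIn κ.kerSubgroup w)) j₁
            (fun g m ↦ hj₁ ((g : decomp (K := K) w) : absoluteGaloisGroup K) m))) ∧
        (∀ w : HeightOneSpectrum (𝓞 K), w ∉ (↑Sf : Set (HeightOneSpectrum (𝓞 K))) → ((p : ℕ) : 𝓞 K) ∉ w.asIdeal →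
          Function.Injective (resH1Hom (ContinuousMonoidHom.id (inertiaIn κ.kerSubgroup w)) (AddSubgroup.inclusion (geomTorsion_le_geomPrimaryTorsion (W.baseChange K) p))
            (fun (g : inertiaIn κ.kerSubgroup w) (m : ↥((W.baseChange K).geomTorsion (p : ℤ))) ↦
              (rfl : (AddSubgroup.inclusion (geomTorsion_le_geomPrimaryTorsion (W.baseChange K) p)) (((g : decomp (K := K) w) : absoluteGaloisGroup K) • m) =
                ((g : decomp (K := K) w) : absoluteGaloisGroup K) • (AddSubgroup.inclusion (geomTorsion_le_geomPrimaryTorsion (W.baseChange K) p)) m)))) ∧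
        (∀ w : HeightOneSpectrum (𝓞 K), w ∉ (↑Sf : Set (HeightOneSpectrum (𝓞 K))) → ((p : ℕ) : 𝓞 K) ∉ w.asIdeal →
          Function.Injective (resH1Hom (ContinuousMonoidHom.id (inertiaIn κ.kerSubgroup w)) j₃
            (fun g m ↦ hj₃ ((g : decomp (K := K) w) : absoluteGaloisGroup K) m))) ∧
        -- SUR
        (∀ y : Fin (p ^ c) → subgroupH1 (κ.kerSubgroup ⊓ decomp vbar) (charModule ∅ θsub), ∃ u ∈ unramifiedOutside κ.kerSubgroup (charModule ∅ θsub) p (↑Sf : Set (HeightOneSpectrum (𝓞 K))),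
          ∀ i : Fin (p ^ c), resOfLe (charModule ∅ θsub) (inf_le_left : κ.kerSubgroup ⊓ decomp vbar ≤ κ.kerSubgroup) (conjH1 κ.kerSubgroup (charModule ∅ θsub) (τ i) u) = y i) ∧
        (∀ y : Fin (p ^ c) → subgroupH1 (κ.kerSubgroup ⊓ decomp vbar) ↥((W.baseChange K).geomPrimaryTorsion p), ∃ u ∈ unramifiedOutside κ.kerSubgroup ↥((W.baseChange K).geomPrimaryTorsion p) p (↑Sf : Set (HeightOneSpectrum (𝓞 K))),
          ∀ i : Fin (p ^ c), resOfLe ↥((W.baseChange K).geomPrimaryTorsion p) (inf_le_left : κ.kerSubgroup ⊓ decomp vbar ≤ κ.kerSubgroup) (conjH1 κ.kerSubgroup ↥((W.baseChange K).geomPrimaryTorsion p) (τ i) u) = y i) ∧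
        (∀ y : Fin (p ^ c) → subgroupH1 (κ.kerSubgroup ⊓ decomp vbar) (charModule ∅ θquot), ∃ u ∈ unramifiedOutside κ.kerSubgroup (charModule ∅ θquot) p (↑Sf : Set (HeightOneSpectrum (𝓞 K))),
          ∀ i : Fin (p ^ c), resOfLe (charModule ∅ θquot) (inf_le_left : κ.kerSubgroup ⊓ decomp vbar ≤ κ.kerSubgroup) (conjH1 κ.kerSubgroup (charModule ∅ θquot) (τ i) u) = y i) ∧
        -- COT
        (∀ s : (datumStrictSelmer κ.kerSubgroup (charModule ∅ θsub) p (AcSelmer.bdpData (charModule ∅ θsub) p vbar) (↑Sf : Set (HeightOneSpectrum (𝓞 K)))), ∃ n : ℕ, p ^ n • s = 0) ∧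
        (∀ s : (datumStrictSelmer κ.kerSubgroup ↥((W.baseChange K).geomPrimaryTorsion p) p (AcSelmer.bdpData ↥((W.baseChange K).geomPrimaryTorsion p) p vbar) (↑Sf : Set (HeightOneSpectrum (𝓞 K)))), ∃ n : ℕ, p ^ n • s = 0) ∧
        (∀ s : (datumStrictSelmer κ.kerSubgroup (charModule ∅ θquot) p (AcSelmer.bdpData (charModule ∅ θquot) p vbar) (↑Sf : Set (HeightOneSpectrum (𝓞 K)))), ∃ n : ℕ, p ^ n • s = 0) ∧
        Finite (AddSubgroup.torsionBy (datumStrictSelmer κ.kerSubgroup (charModule ∅ θsub) p (AcSelmer.bdpData (charModule ∅ θsub) p vbar) (↑Sf : Set (HeightOneSpectrum (𝓞 K)))) (p : ℤ)) ∧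
        Finite (AddSubgroup.torsionBy (datumStrictSelmer κ.kerSubgroup ↥((W.baseChange K).geomPrimaryTorsion p) p (AcSelmer.bdpData ↥((W.baseChange K).geomPrimaryTorsion p) p vbar) (↑Sf : Set (HeightOneSpectrum (𝓞 K)))) (p : ℤ)) ∧
        Finite (AddSubgroup.torsionBy (datumStrictSelmer κ.kerSubgroup (charModule ∅ θquot) p (AcSelmer.bdpData (charModule ∅ θquot) p vbar) (↑Sf : Set (HeightOneSpectrum (𝓞 K)))) (p : ℤ)) ∧
        -- global H⁰
        (∀ x : (charModule ∅ θsub), (∀ g : ↥κ.kerSubgroup, g • x = x) → ∃ x' : (charModule ∅ θsub), (∀ g : ↥κ.kerSubgroup, g • x' = x') ∧ p • x' = x) ∧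
        (∀ x : ↥((W.baseChange K).geomPrimaryTorsion p), (∀ g : ↥κ.kerSubgroup, g • x = x) → ∃ x' : ↥((W.baseChange K).geomPrimaryTorsion p), (∀ g : ↥κ.kerSubgroup, g • x' = x') ∧ p • x' = x) ∧
        (∀ x : (charModule ∅ θquot), (∀ g : ↥κ.kerSubgroup, g • x = x) → ∃ x' : (charModule ∅ θquot), (∀ g : ↥κ.kerSubgroup, g • x' = x') ∧ p • x' = x) ∧
        (∀ n : ↥((W.baseChange K).geomTorsion (p : ℤ)), (∀ g : ↥κ.kerSubgroup, g • n = n) → n = 0) ∧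
        Finite {n : Φ.Quot // ∀ g : ↥κ.kerSubgroup, g • n = n} ∧
        Nat.card {n : Φ.Quot // ∀ g : ↥κ.kerSubgroup, g • n = n} = p ^ (if ∀ σ : absoluteGaloisGroup K, θquot σ = 1 then 1 else 0) ∧
        -- local H⁰ at `H ⊓ D_v̄`
        (∀ n : Φ.Sub, (∀ g : ↥(κ.kerSubgroup ⊓ decomp vbar), g • n = n) → n = 0) ∧
        (∀ (g : ↥(κ.kerSubgroup ⊓ decomp vbar)) (n : Φ.Quot), g • n = n) ∧
        Finite Φ.Quot ∧ Nat.card Φ.Quot = p ∧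
        (∀ x : (charModule ∅ θsub), (∀ g : ↥(κ.kerSubgroup ⊓ decomp vbar), g • x = x) → ∃ x' : (charModule ∅ θsub), (∀ g : ↥(κ.kerSubgroup ⊓ decomp vbar), g • x' = x') ∧ p • x' = x) ∧
        (∀ x : (charModule ∅ θquot), (∀ g : ↥(κ.kerSubgroup ⊓ decomp vbar), g • x = x) → ∃ x' : (charModule ∅ θquot), (∀ g : ↥(κ.kerSubgroup ⊓ decomp vbar), g • x' = x') ∧ p • x' = x) ∧
        -- H² bookkeeping
        Nat.card (↥(unramifiedOutside κ.kerSubgroup Φ.Quot p (↑Sf : Set (HeightOneSpectrum (𝓞 K)))) ⧸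
            ((unramifiedOutside κ.kerSubgroup ↥((W.baseChange K).geomTorsion (p : ℤ)) p (↑Sf : Set (HeightOneSpectrum (𝓞 K)))).map (resH1Hom (ContinuousMonoidHom.id ↥κ.kerSubgroup) Φ.proj
              (fun g b ↦ Φ.proj_smul (g : absoluteGaloisGroup K) b))).addSubgroupOf
                (unramifiedOutside κ.kerSubgroup Φ.Quot p (↑Sf : Set (HeightOneSpectrum (𝓞 K))))) *
            Nat.card (ModN (unramifiedOutside κ.kerSubgroup ↥((W.baseChange K).geomPrimaryTorsion p) p (↑Sf : Set (HeightOneSpectrum (𝓞 K)))) p) =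
          Nat.card (ModN (unramifiedOutside κ.kerSubgroup (charModule ∅ θsub) p (↑Sf : Set (HeightOneSpectrum (𝓞 K)))) p) * Nat.card (ModN (unramifiedOutside κ.kerSubgroup (charModule ∅ θquot) p (↑Sf : Set (HeightOneSpectrum (𝓞 K)))) p) := by
  have hp2 : p ≠ 2 := by omega
  haveI hEK : (W.baseChange K).IsElliptic := inferInstanceAs (W.map (algebraMap ℚ K)).IsElliptic
  have hγ : κ.IsTopGenerator γ := Fact.out
  -- the residual line with its socle embeddings
  obtain ⟨Φ, hSub, hQuot, ⟨j₁, hj₁, hj₁inj, hr₁⟩, ⟨j₃, hj₃, hj₃inj, hr₃⟩⟩ :=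
    ResidualPairStableLine.exists_stableLine_of_isResidualPairOver (W.baseChange K) hpair
  -- the exponent `c` and the representatives `γ ^ i`
  obtain ⟨c, hc, hcd⟩ := IndexInputsReps.exists_pow_generates_decomp_of_isImaginaryQuadratic κ hK hvbar
  obtain ⟨hτ, hdist, hreps⟩ := IndexInputsReps.reps_package_of_pow_generates κ vbar hγ hc hcd
  -- SUR ×3 (x1's package, reduction-free)
  have hsur := sur_package h263 h41 h42 h5A h32 W p hp K hK hH ι v vbar hv hvbar hne κ hκ γ θsub θquot hpair Sf hSf hSsub
    hSquot c hc hcd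
  obtain ⟨hsur₁, hsur₂, hsur₃⟩ := hsur
  -- COT ×6, H⁰ ×13 (split)
  have hpack := cot_hZero_package_split W p hp hsplitred K hK hsplit htor vbar hvbar κ hκ γ θsub θquot hpair hram Sf hSf hfgS
    htorS hμS hSsub hSquot Φ hSub hQuot j₁ hj₁ hj₁inj j₃ hj₃ hj₃inj
  obtain ⟨hprim₁, hprim₂, hprim₃, hfin₁, hfin₂, hfin₃, hinv₁, hinv₂, hinv₃, hN₂, hfinq, hε, hN₁D, htrivD, hfinQ, hN₃, hfinED,
      hinvD₁, hinvD₃⟩ := hpack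
  -- the curve-side Kummer conjuncts
  have hr₂ : ∀ x : ↥((W.baseChange K).geomPrimaryTorsion p),
      x ∈ (AddSubgroup.inclusion (geomTorsion_le_geomPrimaryTorsion (W.baseChange K) p)).range ↔ p • x = 0 := by
    intro x
    constructor
    · rintro ⟨y, rfl⟩
      apply Subtype.ext
      rw [AddSubgroupClass.coe_nsmul, AddSubgroup.coe_inclusion, ZeroMemClass.coe_zero, ← natCast_zsmul]
      exact (Submodule.mem_torsionBy_iff _ _).mp y.2
    · intro hx
      have hx' : (p : ℤ) • (x : geomPoints (W.baseChange K)) = 0 := by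
        rw [natCast_zsmul, ← AddSubgroupClass.coe_nsmul, hx, ZeroMemClass.coe_zero]
      exact ⟨⟨(x : geomPoints (W.baseChange K)), (Submodule.mem_torsionBy_iff _ _).mpr hx'⟩, Subtype.ext rfl⟩
  have hd₂ : ∀ x : ↥((W.baseChange K).geomPrimaryTorsion p), ∃ x' : ↥((W.baseChange K).geomPrimaryTorsion p),
      p • x' = x :=
    (W.baseChange K).exists_nsmul_eq_geomPrimaryTorsion p (W.baseChange K).zsmul_geomPoints_surjective_holds
  have hθsub : ∀ σ : absoluteGaloisGroup K, θsub σ ^ (p - 1) = 1 := fun σ ↦ (hpair.pow_sub_one σ).1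
  have hθquot : ∀ σ : absoluteGaloisGroup K, θquot σ ^ (p - 1) = 1 := fun σ ↦ (hpair.pow_sub_one σ).2
  -- H² (x1-p1-w4 g5, reduction-free; `cd_p ≤ 2` by name)
  have hH2' := IndexInputsH2.natCard_H2_conjunct hCD2 h41 h42 h5A h32 W hp hK hH hv hvbar hne κ hκ γ hpair Sf hSf hSsub hSquot Φ
    j₁ j₃ hj₁ hj₃ hj₁inj hj₃inj hr₁ hr₃
  exact ⟨c, fun i : ℕ ↦ γ ^ i, Φ, j₁, j₃, hj₁, hj₃, hτ, hdist, hreps _, hreps _, hreps _, hj₁inj, hj₃inj, hr₁, hr₃, hr₂, hd₂,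
    fun w hw hpw ↦ IndexInputsH0.injective_resH1Hom_inertiaIn_incl W κ.kerSubgroup Sf hSf Φ w hw hpw,
    fun w _ _ ↦ IndexInputsH0.injective_resH1Hom_inertiaIn_of_charModule κ.kerSubgroup θsub hθsub j₁ hj₁ hj₁inj hr₁ w,
    fun w hw hpw ↦ IndexInputsH0.injective_resH1Hom_inertiaIn_inclusion W κ.kerSubgroup Sf hSf w hw hpw,
    fun w _ _ ↦ IndexInputsH0.injective_resH1Hom_inertiaIn_of_charModule κ.kerSubgroup θquot hθquot j₃ hj₃ hj₃inj hr₃ w,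
    hsur₁, hsur₂, hsur₃, hprim₁, hprim₂, hprim₃, hfin₁, hfin₂, hfin₃,
    hinv₁, hinv₂, hinv₃, hN₂, hfinq, hε, hN₁D, htrivD, hfinQ, hN₃, hinvD₁, hinvD₃, hH2'⟩

end Summit.BirchSwinnertonDyer.BirchSwinnertonDyer.Theorems.SplitMultIndexInputs

end
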